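import Literature.NumberTheory.GaloisRepresentations.LocalWeilDatum
import Literature.NumberTheory.GaloisRepresentations.LocalReciprocityThetaProofs
import HarnessLib

/-!
# The Weil datum of a non-archimedean local field, III: the unramified levels `deg⁻¹(nℤ) = W_F ∩ G_{F_n}`

Continuation of `LocalWeilDatum.lean`.  Neukirch's abstract class field theory (Ch. IV §4) needs,
among the axioms of the datum `(W_F, deg, (F^sep)ˣ, v)` (`AbstractClassFieldTheory.WeilDatum`),
that the subgroups `deg⁻¹(nℤ) ≤ W_F` (`AbstractCFT.degMultiples`) are *fields*, i.e. of the form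
`W_F ∩ G_K` for a finite separable `K ⊆ F̄`: `K = F_n`, the unramified extension of degree `n`.
This file proves it (`LocalWeilDatum.isFieldSubgroup_degMultiples`) with

* `F_n = F(ζ)` for a primitive `(q^n - 1)`-th root of unity `ζ ∈ F̄` (`unramifiedLevel F n`;
  `q = #𝓀[F]`; `q ^ n - 1` is prime to `p`);
* the computation of the Weil group on roots of unity of order prime to `p`: an element of degree
  `k ≥ 0` acts as `ζ ↦ ζ ^ (q ^ k)` (`smul_eq_pow_of_isFrobPow`: both sides are roots of unity
  congruent modulo `𝔓`, hence equal, `eq_of_pow_eq_one_of_sub_mem_absMaximalIdeal`), so it fixes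
  `ζ` iff `q ^ n - 1 ∣ q ^ k - 1` iff `n ∣ k` (`Nat.pow_sub_one_mod_pow_sub_one`);
* hence `fieldSubgroup F (F_n) = degMultiples (degHom F) n` (`fieldSubgroup_unramifiedLevel`).

## References

* J. Neukirch, *Algebraic Number Theory*, Springer 1999, Ch. IV §4 (the unramified extensions
  `K̃ = ∪ K_n`, `d_K`), Ch. V §1 (local case). [NeukirchANT1999]
* J.-P. Serre, *Local Fields*, GTM 67, Ch. IV §4, Prop. 16 and Cor. (roots of unity of order prime
  to `p` and `K_nr`), Ch. III §5. [SerreLocalFields1979]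
-/

noncomputable section

open Field IsNonarchimedeanLocalField ValuativeRel
open scoped Pointwise Valued

namespace Literature.NumberTheory.GaloisRepresentations

namespace LocalWeilDatum

open AbstractCFT GaloisRepresentations.IsNonarchimedeanLocalField

/-! ### A divisibility lemma -/

/-- `a ^ b - 1 ∣ a ^ c - 1 ↔ b ∣ c` for `a ≥ 2`. [folklore] -/
theorem pow_sub_one_dvd_pow_sub_one_iff {a b c : ℕ} (ha : 2 ≤ a) :
    a ^ b - 1 ∣ a ^ c - 1 ↔ b ∣ c := by
  rw [Nat.dvd_iff_mod_eq_zero, Nat.pow_sub_one_mod_pow_sub_one, Nat.dvd_iff_mod_eq_zero]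
  have h1 : 1 ≤ a ^ (c % b) := Nat.one_le_pow _ _ (by omega)
  constructor
  · intro h
    have h2 : a ^ (c % b) = 1 := by omega
    rcases Nat.pow_eq_one.mp h2 with h3 | h3
    · omega
    · exact h3
  · intro h
    rw [h, pow_zero, Nat.sub_self]

section Local

variable (F : Type*) [Field F] [ValuativeRel F] [TopologicalSpace F] [IsNonarchimedeanLocalField F]

/-! ### Roots of unity of order `q ^ n - 1` -/

/-- `q ^ n - 1` is prime to the residue characteristic `p` (`q = p ^ f`, `n ≥ 1`). [folklore] -/
theorem not_ringChar_dvd_residueFieldCard_pow_sub_one {n : ℕ} (hn : 0 < n) :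
    ¬ ringChar 𝓀[F] ∣ residueFieldCard F ^ n - 1 := by
  obtain ⟨f, hf0, hqp⟩ := residueFieldCard_eq_pow_ringChar F
  have hp : (ringChar 𝓀[F]).Prime := by
    letI := Fintype.ofFinite 𝓀[F]
    obtain ⟨m, hp, -⟩ := FiniteField.card 𝓀[F] (ringChar 𝓀[F])
    exact hp
  have hQ1 : 1 ≤ residueFieldCard F ^ n := Nat.one_le_pow _ _ (by linarith [one_lt_residueFieldCard F])
  intro hdvd
  have hdvdQ : ringChar 𝓀[F] ∣ residueFieldCard F ^ n := by
    rw [hqp, ← pow_mul]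
    exact dvd_pow_self _ (Nat.mul_ne_zero hf0.ne' hn.ne')
  have h1 : ringChar 𝓀[F] ∣ residueFieldCard F ^ n - (residueFieldCard F ^ n - 1) := Nat.dvd_sub hdvdQ hdvd
  rw [Nat.sub_sub_self hQ1, Nat.dvd_one] at h1
  exact hp.one_lt.ne' h1

/-- `q ^ n - 1 ≠ 0`. [folklore] -/
theorem residueFieldCard_pow_sub_one_ne_zero (n : ℕ) (hn : 0 < n) : residueFieldCard F ^ n - 1 ≠ 0 := by
  have := Nat.one_lt_pow hn.ne' (one_lt_residueFieldCard F)
  omega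

/-- A primitive `(q ^ n - 1)`-th root of unity exists in `F̄`. [folklore] -/
theorem exists_isPrimitiveRoot_residueFieldCard_pow_sub_one {n : ℕ} (hn : 0 < n) :
    ∃ ζ : AlgebraicClosure F, IsPrimitiveRoot ζ (residueFieldCard F ^ n - 1) := by
  haveI : NeZero (((residueFieldCard F ^ n - 1 : ℕ)) : F) :=
    ⟨natCast_ne_zero_of_not_dvd F (not_ringChar_dvd_residueFieldCard_pow_sub_one F hn)⟩
  exact HasEnoughRootsOfUnity.exists_primitiveRoot (AlgebraicClosure F) _

/-- A chosen primitive `(q ^ n - 1)`-th root of unity `ζ_n ∈ F̄` (`n ≥ 1`; junk `1` for `n = 0`).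
[cite: SerreLocalFields1979, Ch. IV §4 Prop. 16] -/
def rootOfUnramifiedLevel (n : ℕ) : AlgebraicClosure F := by
  classical
  exact if hn : 0 < n then (exists_isPrimitiveRoot_residueFieldCard_pow_sub_one F hn).choose else 1

/-- `ζ_n` is a primitive `(q ^ n - 1)`-th root of unity. [folklore] -/
theorem isPrimitiveRoot_rootOfUnramifiedLevel {n : ℕ} (hn : 0 < n) :
    IsPrimitiveRoot (rootOfUnramifiedLevel F n) (residueFieldCard F ^ n - 1) := by
  classical
  unfold rootOfUnramifiedLevel
  rw [dif_pos hn]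
  exact (exists_isPrimitiveRoot_residueFieldCard_pow_sub_one F hn).choose_spec

/-- **The unramified level `F_n = F(ζ_n)`**, `ζ_n` a primitive `(q ^ n - 1)`-th root of unity: the
unramified extension of degree `n` of `F` inside `F̄`.
[cite: SerreLocalFields1979, Ch. IV §4 Cor. to Prop. 16; NeukirchANT1999, Ch. IV §4] -/
def unramifiedLevel (n : ℕ) : IntermediateField F (AlgebraicClosure F) :=
  IntermediateField.adjoin F {rootOfUnramifiedLevel F n}

/-- `F_n / F` is finite, abelian, and fixed pointwise by the inertia group.
[cite: SerreLocalFields1979, Ch. IV §4 Cor. to Prop. 16] -/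
theorem unramifiedLevel_finite_abelian_unramified {n : ℕ} (hn : 0 < n) :
    FiniteDimensional F (unramifiedLevel F n) ∧ IsAbelianGalois F (unramifiedLevel F n) ∧
      ∀ σ ∈ absInertia F, ∀ x : unramifiedLevel F n, σ • (x : AlgebraicClosure F) = x :=
  adjoin_rootOfUnity_finite_abelian_unramified F (not_ringChar_dvd_residueFieldCard_pow_sub_one F hn)
    (residueFieldCard_pow_sub_one_ne_zero F n hn) (isPrimitiveRoot_rootOfUnramifiedLevel F hn).pow_eq_one

/-- `F_n ⊆ F^sep`. [folklore] -/
theorem unramifiedLevel_le_sepClosure {n : ℕ} (hn : 0 < n) : unramifiedLevel F n ≤ sepClosure F := by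
  obtain ⟨h1, h2, -⟩ := unramifiedLevel_finite_abelian_unramified F hn
  haveI := h1
  haveI := h2
  exact (le_separableClosure_iff F (AlgebraicClosure F) _).mpr inferInstance

/-! ### The Weil group on roots of unity of order prime to `p` -/

/-- **An element of degree `k ≥ 0` acts on roots of unity of order prime to `p` as `ζ ↦ ζ ^ (q ^ k)`**:
`σ ζ ≡ ζ ^ (q ^ k) (mod 𝔓)` by definition of `IsFrobPow`, and roots of unity of order prime to `p`
congruent modulo `𝔓` are equal.
[cite: SerreLocalFields1979, Ch. IV §4 Prop. 16] -/
theorem smul_eq_pow_of_isFrobPow {m : ℕ} (hm : ¬ ringChar 𝓀[F] ∣ m) (hm0 : m ≠ 0)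
    {σ : absoluteGaloisGroup F} {k : ℕ} (hσ : IsFrobPow σ (k : ℤ)) {ζ : AlgebraicClosure F}
    (hζ : ζ ^ m = 1) : σ • ζ = ζ ^ residueFieldCard F ^ k := by
  have hζint : IsIntegral 𝒪[F] ζ := by
    refine ⟨Polynomial.X ^ m - 1, Polynomial.monic_X_pow_sub_C (1 : 𝒪[F]) hm0, ?_⟩
    simp [hζ]
  set z : absIntegers 𝒪[F] F := ⟨ζ, hζint⟩ with hz
  have hzm : z ^ m = 1 := Subtype.ext (by simpa [hz] using hζ)
  have hσz : (σ • z) ^ m = 1 := by rw [← smul_pow', hzm, smul_one]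
  have hzq : (z ^ residueFieldCard F ^ k) ^ m = 1 := by rw [← pow_mul, mul_comm, pow_mul, hzm, one_pow]
  have h := eq_of_pow_eq_one_of_sub_mem_absMaximalIdeal F hm hm0 hσz hzq
    ((isFrobPow_natCast_iff.mp hσ) z)
  have := congrArg Subtype.val h
  simpa [hz] using this

/-- For a primitive `(q ^ n - 1)`-th root of unity `ζ` and `σ` of degree `k ≥ 0`:
`σ ζ = ζ ↔ n ∣ k`. [cite: NeukirchANT1999, Ch. IV §4 (`d_K` and the unramified tower)] -/
theorem smul_eq_self_iff_dvd_of_isFrobPow {n : ℕ} (hn : 0 < n) {ζ : AlgebraicClosure F}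
    (hζ : IsPrimitiveRoot ζ (residueFieldCard F ^ n - 1)) {σ : absoluteGaloisGroup F} {k : ℕ}
    (hσ : IsFrobPow σ (k : ℤ)) : σ • ζ = ζ ↔ n ∣ k := by
  have hq : 2 ≤ residueFieldCard F := one_lt_residueFieldCard F
  have hm0 := residueFieldCard_pow_sub_one_ne_zero F n hn
  rw [smul_eq_pow_of_isFrobPow F (not_ringChar_dvd_residueFieldCard_pow_sub_one F hn) hm0 hσ
    hζ.pow_eq_one, ← pow_sub_one_dvd_pow_sub_one_iff hq, ← hζ.pow_eq_one_iff_dvd]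
  have hζ0 : ζ ≠ 0 := hζ.ne_zero hm0
  have hQ1 : 1 ≤ residueFieldCard F ^ k := Nat.one_le_pow _ _ (by omega)
  constructor
  · intro h
    apply mul_right_cancel₀ hζ0
    rw [← pow_succ, Nat.sub_add_cancel hQ1, h, one_mul]
  · intro h
    rw [← Nat.sub_add_cancel hQ1, pow_succ, h, one_mul]

/-- An automorphism fixing `ζ_n` fixes `F_n` pointwise, and conversely. [folklore] -/
theorem forall_smul_eq_self_unramifiedLevel_iff (n : ℕ) {σ : absoluteGaloisGroup F} :
    (∀ x ∈ unramifiedLevel F n, σ • x = x) ↔ σ • rootOfUnramifiedLevel F n = rootOfUnramifiedLevel F n :=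
  ⟨fun h => h _ (IntermediateField.mem_adjoin_simple_self F _),
    fun h _ hx => smul_eq_self_of_mem_adjoin_simple F h hx⟩

/-- **`W_F ∩ G_{F_n} = deg⁻¹(nℤ)`**: an element of the Weil group fixes the unramified level `F_n`
iff its degree is a multiple of `n`.
[cite: NeukirchANT1999, Ch. IV §4 (`K̃|K`, `d_K`); SerreLocalFields1979, Ch. IV §4 Cor. to Prop. 16] -/
theorem fieldSubgroup_unramifiedLevel {n : ℕ} (hn : 0 < n) :
    fieldSubgroup F (unramifiedLevel F n) = degMultiples (degHom F) n := by
  have hζ := isPrimitiveRoot_rootOfUnramifiedLevel F hn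
  -- the case of non-negative degree
  have key : ∀ (w : WeilGroup F) (k : ℕ), WeilGroup.deg w = k →
      (w ∈ fieldSubgroup F (unramifiedLevel F n) ↔ n ∣ k) := by
    intro w k hk
    have hσ : IsFrobPow (WeilGroup.toAbsGalois F w) (k : ℤ) :=
      (WeilGroup.deg_eq_iff IsFrobPow.mul_holds IsFrobPow.unique_holds).mp hk
    rw [mem_fieldSubgroup_iff, forall_smul_eq_self_unramifiedLevel_iff,
      smul_eq_self_iff_dvd_of_isFrobPow F hn hζ hσ]
  ext w
  rw [AbstractCFT.mem_degMultiples_iff, degZ_degHom]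
  rcases Int.eq_nat_or_neg (WeilGroup.deg w) with ⟨k, hk | hk⟩
  · rw [key w k hk, hk, Int.natCast_dvd_natCast]
  · have hk' : WeilGroup.deg w⁻¹ = k := by
      rw [WeilGroup.deg_inv IsFrobPow.mul_holds IsFrobPow.unique_holds, hk, neg_neg]
    rw [← inv_mem_iff (x := w), key w⁻¹ k hk', hk, dvd_neg, Int.natCast_dvd_natCast]

/-- **The unramified levels are fields of the Weil datum**: `deg⁻¹(nℤ) ≤ W_F` is the Weil subgroup
of the finite separable `F_n ⊆ F̄` (`n ≥ 1`). [cite: NeukirchANT1999, Ch. IV §4; Ch. V §1] -/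
theorem isFieldSubgroup_degMultiples (n : ℕ) (hn : 0 < n) : IsFieldSubgroup F (degMultiples (degHom F) n) := by
  obtain ⟨h1, -, -⟩ := unramifiedLevel_finite_abelian_unramified F hn
  exact ⟨unramifiedLevel F n, h1, unramifiedLevel_le_sepClosure F hn, (fieldSubgroup_unramifiedLevel F hn).symm⟩

end Local

end LocalWeilDatum

end Literature.NumberTheory.GaloisRepresentations
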